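/-
Copyright (c) 2026 the pub-hodgecm-mathlib formalisation cell (harness21).  Prover seat hodgecm-mathlib-K2Liu-p05 (g5), Track B «K2-LIT»,
#184♮ = hLiu418 = `stmt-HodgeConjecture-24832`; #42S payer road, organ S1 (local Siegel–Weil spanning), ROAD W file F6c
(LEAD F0P6-plan (g14) RULING «M-158b» (1), BATCH #3; sequel of ★ F6a+b `K2LiuLocalSWMiddleCellFunctional`).
-/
import Summits.HodgeConjecture.HodgeConjecture.Theorems.K2LiuLocalSWMiddleCellFunctional   -- ★ F6a+b: the middle-cell value functional
import HarnessLib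

/-!
# Crux `HLiu418`, #42S organ S1, ROAD W, file F6c: THE MIDDLE CELL TIMES THE SIEGEL UNIPOTENTS —
# `F_Ψ(w₁ · n(t)) = c · Λ(op(P)⁻¹ (n(c_t) (op(P) Ψ)))`, `c ≠ 0`, ANY mover-implementer `P` (the `t`-dependence of the middle-cell restriction, explicitly)

Cell `hodgecm-mathlib`, crux item hLiu418 = `stmt-HodgeConjecture-24832`; squad K2 ∕ K2Liu; LEAD F0P6-plan (g14), organ lead K2Liu-p06 (g4);
prover K2Liu-p05 (g5).  THEOREMS ONLY (no `def`, no instance, no notation, no named-fact hypothesis, no `sorry`); lane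
`--supports stmt-HodgeConjecture-24832 --as helper`.

WHY.  ROAD W's (W3a) asks that `u = F_Φ − λ F_{Φ′}` VANISH ON THE MIDDLE CELL `P_Δ w₁ P_Δ = P_Δ · w₁ · N_Δ M_Δ`; by the Siegel law on the left
and ★ `swSectionLoc_mul_right` on the right this is a statement about `t ↦ F_Ψ(w₁ · n(t))` (and the Levi scalars `m(a)`, ★ `K2LiuLocalSWLeviScalars`).
★ F6a+b gives `F_Ψ(w₁) = c · Λ Ψ` (`c ≠ 0`, `Λ` any linear functional with the pure-tensor values `(∫ Γ₁Φ₁) · (Γ₂Φ₂)(0)`); this file composes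
it with ★ F4a's EXACT unipotent word `implementer_localOmega_nElem_apply` through ANY implementer `P ∈ S̃p_ψ(𝕎^𝔻_T)` over a mover of `ℓ_Δ` onto `ℓ_Y`
(`hpar` by ★ `parabolicAtUnipotents_localSplittingDatumCM`): **`F_Ψ(w₁ · n(t)) = c · Λ(op(P)⁻¹ (unipOpPi c_t (op(P) Ψ)))`**, `c_t = cOfFix 𝕋 (π(P) ι(n(t)) π(P)⁻¹)`.
Choices of `P`: Kudla's `j̃(p₁, p₂)` (★ `boxLoc`, a mover-implementer by ★ F6a+b `map_deltaLagrangian_proj_boxLoc`, `op = op(p₁) ⊠ op(p₂)` by ★ `toOp_boxLoc`) — then for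
the consumer's `Λ = Λ₀ ∘ (op(p₁) ⊠ op(p₂))` the middle restriction is `c · Λ₀(ψ_v(−½⟨x, c_t x⟩) · (op(p₁) ⊠ op(p₂))Ψ)`: the `t`-dependence sits in ONE character of
second degree read on the support of `Λ₀ = Haar₁ ⊗ δ₀` (DESIGN-W3-v2 §0 (a)'s `\widehat{κ(ΓΦ)}(t)`) —, or the outer `m₀` itself.
* `exists_ne_zero_swSectionLoc_blkLoc_weylDelta_mul_nElem` — the statement above (binders of ★ F6a+b §4 + `(P, hP)` + a skew `t`).
NOT HERE: the Levi scalars `m(a)` (★ `K2LiuLocalSWLeviScalars` + the Levi twin ★ `leraySection_deltaLagrangian_apply_eq_conj_leviOpPi`), the explicit block form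
of `⟨x₁ ⊔ 0, c_t (x₁ ⊔ 0)⟩` (★ `dotProduct_cOfFix_mover_conj`), ref1's (A-W2) R2.
References: [Kudla1994] §3 Thm. 3.1; [Rangarao1993] Lemma 3.2 (3.8), p. 351; [MoeglinVignerasWaldspurger1987] Chap. 2 II.1 Rem. (6), II.6; [Kudla1984] §1;
[KudlaRallis1994] §1; [HarrisKudlaSweet1996] §1 (1.15)–(1.16).
HONEST LABEL.  Count-neutral helper: `HC_CM` is proved only modulo the 7 printed citations (2 remaining named inputs: hLiu418 = `stmt-HodgeConjecture-24832`,
h413 = `stmt-HodgeConjecture-24833`) until rung 0 closes.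
-/

set_option autoImplicit false
set_option linter.dupNamespace false -- the mandated namespace repeats `HodgeConjecture.HodgeConjecture`

noncomputable section

open scoped Matrix
open NumberField IsDedekindDomain MeasureTheory MeasureTheory.Measure Matrix
open Literature.RepresentationTheory.HeisenbergGroup Literature.RepresentationTheory.HeisenbergGroup.SymplecticMatrix
open Literature.NumberTheory.Automorphic Literature.NumberTheory.Automorphic.UnitaryGroup Literature.NumberTheory.Weil1964
open Literature.NumberTheory.GaloisRepresentations Literature.NumberTheory.GaloisRepresentations.IsNonarchimedeanLocalField
open Literature.RepresentationTheory.HarrisKudlaSweet1996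
open Literature.NumberTheory.GelbartRogawski1991.UnitaryDualPair
open Literature.NumberTheory.GelbartRogawski1991.UnitaryDualPair.LocalSplitting
open Literature.NumberTheory.GelbartRogawski1991.UnitaryDualPair.LocalSplitting.DoubledBlock
open Summit.HodgeConjecture.HodgeConjecture.Cruxes.HLiu418.K2LiuLocalSWSectionDefs
open Summit.HodgeConjecture.HodgeConjecture.Cruxes.HLiu418.K2LiuLocalSWBigCellWords

open Summit.HodgeConjecture.HodgeConjecture.Cruxes.HLiu418.K2LiuLocalSWMiddleCellFunctional

namespace Summit.HodgeConjecture.HodgeConjecture.Cruxes.HLiu418.K2LiuLocalSWMiddleCellValues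

variable (L : Type) [Field L] [NumberField L] [IsCMField L] (v : HeightOneSpectrum (𝓞 (maximalRealSubfield L)))
  [MeasurableSpace (v.adicCompletion (maximalRealSubfield L))] [BorelSpace (v.adicCompletion (maximalRealSubfield L))]
  (μ : Measure (v.adicCompletion (maximalRealSubfield L))) [μ.IsAddHaarMeasure]
  (n₁ n₂ : ℕ) {T₁ : Matrix (Fin n₁) (Fin n₁) (maximalRealSubfield L)} {T₂ : Matrix (Fin n₂) (Fin n₂) (maximalRealSubfield L)}
  (hT₁ : T₁.IsSymm) (hT₂ : T₂.IsSymm) (hT₁d : IsUnit T₁.det) (hT₂d : IsUnit T₂.det)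

variable (χ : HeckeCharacter L) (hχ : IsSplittingChar L 1 χ)

include hT₁d in
set_option maxHeartbeats 4000000 in -- the doubled CM datum's telescope (as ★ `LocalSplittingCMBlockRestriction`)
/-- **THE MIDDLE CELL TIMES THE SIEGEL UNIPOTENTS.**  With the data of ★ F6a+b (`T = T₁ ⊕ᶠ T₂`, `T₁ = diagonal t₁`, `0 < n₁`; outer `m₀` over ANY mover; block
implementers `p₁ ∈ S̃p_ψ(𝕎^𝔻_{T₁})` Cayley-type and `p₂ ∈ S̃p_ψ(𝕎^𝔻_{T₂})` over movers; a linear `Λ` with the pure-tensor values `(∫ op(p₁)Φ₁) · (op(p₂)Φ₂)(0)`) and ANY implementer `P ∈ S̃p_ψ(𝕎^𝔻_T)`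
over a mover of `ℓ_Δ` onto `ℓ_Y` (`hP`; e.g. Kudla's `j̃(p₁, p₂)` by ★ F6a+b `map_deltaLagrangian_proj_boxLoc` — `op = op(p₁) ⊠ op(p₂)`, ★ `toOp_boxLoc` —, or `m₀` itself):
there is ONE `c ≠ 0` with, for every such `P`, every skew `t` and every `Ψ`, `F_Ψ(w₁ · n(t)) = swSectionLoc v s_T m₀ Ψ (blkLoc w_Δ^{T₁} · n(t)) = c · Λ(op(P)⁻¹ (unipOpPi c_t (op(P) Ψ)))`, `c_t = cOfFix 𝕋 (π(P) ι(n(t)) π(P)⁻¹)` —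
★ `swSectionLoc_mul_right`, ★ F6a+b §4, and ★ F4a's exact unipotent word `implementer_localOmega_nElem_apply` through `(π(P), op(P))`
(`hpar` by ★ `parabolicAtUnipotents_localSplittingDatumCM`).  For the consumer's `Λ = Λ₀ ∘ op(P)` the middle restriction is `c · Λ₀(ψ_v(−½⟨x, c_t x⟩) · op(P)Ψ)`.
[cite: Kudla1994, §3 Thm. 3.1] [cite: Rangarao1993, Lemma 3.2 (3.8), p. 351] [cite: MoeglinVignerasWaldspurger1987, Chap. 2 II.1 Rem. (6), II.6] [cite: KudlaRallis1994, §1] -/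
theorem exists_ne_zero_swSectionLoc_blkLoc_weylDelta_mul_nElem (hn₁ : 0 < n₁) (t₁ : Fin n₁ → maximalRealSubfield L)
    (hT₁t : T₁ = Matrix.diagonal t₁)
    (hTv₁ : IsUnit (localGram (maximalRealSubfield L) (n₁ + n₁) (gramD (maximalRealSubfield L) n₁ T₁) v).det)
    (m₀ : LocalMp (maximalRealSubfield L) ((n₁ + n₂) + (n₁ + n₂)) (gramD (maximalRealSubfield L) (n₁ + n₂) (UnitaryGroup.finSum n₁ n₂ T₁ T₂)) v)
    (hm₀ : (deltaLagrangian (maximalRealSubfield L) v (n₁ + n₂)).map (toLin (maximalRealSubfield L) v (MpPsi.proj _ m₀)) =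
      lagrangianY (maximalRealSubfield L) ((n₁ + n₂) + (n₁ + n₂)) v)
    (p₁ : LocalMp (maximalRealSubfield L) (n₁ + n₁) (gramD (maximalRealSubfield L) n₁ T₁) v)
    (hp₁ : (deltaLagrangian (maximalRealSubfield L) v n₁).map (toLin (maximalRealSubfield L) v (MpPsi.proj _ p₁)) = lagrangianY (maximalRealSubfield L) (n₁ + n₁) v)
    (B₁ : GL (Fin (n₁ + n₁)) (v.adicCompletion (maximalRealSubfield L)))
    (hW₁ : MpPsi.proj _ p₁ * iotaD (maximalRealSubfield L) L (IsCMField.complexConj L) (complexConj_imagUnit L) (imagUnit_ne_zero L)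
        (imagUnit_mul_self L) v n₁ hT₁ rfl (weylDelta (maximalRealSubfield L) L (IsCMField.complexConj L) v n₁ (T₀ := T₁) rfl) * (MpPsi.proj _ p₁)⁻¹ =
      (transportSp (localGram (maximalRealSubfield L) (n₁ + n₁) (gramD (maximalRealSubfield L) n₁ T₁) v) hTv₁ (SymplecticGroup.symJ _ _))⁻¹ *
        transportSp (localGram (maximalRealSubfield L) (n₁ + n₁) (gramD (maximalRealSubfield L) n₁ T₁) v) hTv₁ (levi B₁))
    {m : ℤ} (hm : (adeleAddCharAt (maximalRealSubfield L) v).HasConductorExp m)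
    (p₂ : LocalMp (maximalRealSubfield L) (n₂ + n₂) (gramD (maximalRealSubfield L) n₂ T₂) v)
    (hp₂ : (deltaLagrangian (maximalRealSubfield L) v n₂).map (toLin (maximalRealSubfield L) v (MpPsi.proj _ p₂)) = lagrangianY (maximalRealSubfield L) (n₂ + n₂) v)
    (Λ : SchwartzBruhat (Fin ((n₁ + n₂) + (n₁ + n₂)) → v.adicCompletion (maximalRealSubfield L)) →ₗ[ℂ] ℂ)
    (hΛ : ∀ (Φ₁ : SchwartzBruhat (Fin (n₁ + n₁) → v.adicCompletion (maximalRealSubfield L)))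
      (Φ₂ : SchwartzBruhat (Fin (n₂ + n₂) → v.adicCompletion (maximalRealSubfield L))),
      Λ (boxSB (v.adicCompletion (maximalRealSubfield L)) (blkIdx n₁ n₂) Φ₁ Φ₂) =
        (∫ x : Fin (n₁ + n₁) → v.adicCompletion (maximalRealSubfield L),
            ((MpPsi.toOp _ p₁ Φ₁ : SchwartzBruhat (Fin (n₁ + n₁) → v.adicCompletion (maximalRealSubfield L))) :
              (Fin (n₁ + n₁) → v.adicCompletion (maximalRealSubfield L)) → ℂ) x ∂(Measure.pi fun _ => μ)) *
          ((MpPsi.toOp _ p₂ Φ₂ : SchwartzBruhat (Fin (n₂ + n₂) → v.adicCompletion (maximalRealSubfield L))) :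
            (Fin (n₂ + n₂) → v.adicCompletion (maximalRealSubfield L)) → ℂ) 0) :
    ∃ c : ℂ, c ≠ 0 ∧ ∀ (P : LocalMp (maximalRealSubfield L) ((n₁ + n₂) + (n₁ + n₂)) (gramD (maximalRealSubfield L) (n₁ + n₂) (UnitaryGroup.finSum n₁ n₂ T₁ T₂)) v)
      (_hP : (deltaLagrangian (maximalRealSubfield L) v (n₁ + n₂)).map (toLin (maximalRealSubfield L) v (MpPsi.proj _ P)) = lagrangianY (maximalRealSubfield L) ((n₁ + n₂) + (n₁ + n₂)) v)
      (t : Matrix (Fin (n₁ + n₂)) (Fin (n₁ + n₂)) (LocalRing L v))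
      (ht : (t.map (conjLocal L (IsCMField.complexConj L) v))ᵀ * gramS (maximalRealSubfield L) L v (n₁ + n₂) (UnitaryGroup.finSum n₁ n₂ T₁ T₂) +
        gramS (maximalRealSubfield L) L v (n₁ + n₂) (UnitaryGroup.finSum n₁ n₂ T₁ T₂) * t = 0)
      (Ψ : SchwartzBruhat (Fin ((n₁ + n₂) + (n₁ + n₂)) → v.adicCompletion (maximalRealSubfield L))),
      swSectionLoc L v
          (localSplittingDatumCM L v μ (n₁ + n₂) (UnitaryGroup.isSymm_finSum hT₁ hT₂) (isUnit_det_finSum L n₁ n₂ hT₁d hT₂d) rfl χ hχ).localSplitting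
          m₀ Ψ
          (blkLoc (maximalRealSubfield L) L (IsCMField.complexConj L) v n₁ n₂ (T₁ := T₁) (T₂ := T₂) rfl rfl
              (weylDelta (maximalRealSubfield L) L (IsCMField.complexConj L) v n₁ (T₀ := T₁) rfl) *
            nElem (maximalRealSubfield L) L (IsCMField.complexConj L) v (n₁ + n₂) (T₀ := UnitaryGroup.finSum n₁ n₂ T₁ T₂) rfl t ht) =
        c * Λ ((MpPsi.toOp _ P).symm
          (unipOpPi (isLocallyConstant_of_isContinuousNontrivial (isContinuousNontrivial_adeleAddCharAt (maximalRealSubfield L) v))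
            (Matrix.mulVecLin (cOfFix (localGram (maximalRealSubfield L) ((n₁ + n₂) + (n₁ + n₂)) (gramD (maximalRealSubfield L) (n₁ + n₂) (UnitaryGroup.finSum n₁ n₂ T₁ T₂)) v)
              (MpPsi.proj _ P *
                iotaD (maximalRealSubfield L) L (IsCMField.complexConj L) (complexConj_imagUnit L) (imagUnit_ne_zero L) (imagUnit_mul_self L) v
                  (n₁ + n₂) (UnitaryGroup.isSymm_finSum hT₁ hT₂) rfl
                  (nElem (maximalRealSubfield L) L (IsCMField.complexConj L) v (n₁ + n₂) (T₀ := UnitaryGroup.finSum n₁ n₂ T₁ T₂) rfl t ht) *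
                (MpPsi.proj _ P)⁻¹)))
            (MpPsi.toOp _ P Ψ))) := by
  obtain ⟨c, hc0, hc⟩ := exists_ne_zero_swSectionLoc_blkLoc_weylDelta_eq_mul_of_boxSB L v μ n₁ n₂ hT₁ hT₂ hT₁d hT₂d χ hχ hn₁ t₁ hT₁t hTv₁ m₀ hm₀
    (MpPsi.proj _ p₁) hp₁ (MpPsi.toOp _ p₁) (MpPsi.toRep_implements _ p₁) B₁ hW₁ hm (MpPsi.proj _ p₂) hp₂ (MpPsi.toOp _ p₂)
    (MpPsi.toRep_implements _ p₂) Λ hΛ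
  refine ⟨c, hc0, fun P hP t ht Ψ => ?_⟩
  -- the exact unipotent word of the big datum through `(π(P), op(P))`
  have hword := implementer_localOmega_nElem_apply L v μ (n₁ + n₂) (UnitaryGroup.isSymm_finSum hT₁ hT₂) (isUnit_det_finSum L n₁ n₂ hT₁d hT₂d) rfl
    (localSplittingDatumCM L v μ (n₁ + n₂) (UnitaryGroup.isSymm_finSum hT₁ hT₂) (isUnit_det_finSum L n₁ n₂ hT₁d hT₂d) rfl χ hχ)
    (MpPsi.proj _ P) hP (MpPsi.toOp _ P) (MpPsi.toRep_implements _ P) t ht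
    (parabolicAtUnipotents_localSplittingDatumCM L v μ (n₁ + n₂) (UnitaryGroup.isSymm_finSum hT₁ hT₂) (isUnit_det_finSum L n₁ n₂ hT₁d hT₂d) rfl χ hχ
      (MpPsi.proj _ P) hP (MpPsi.toOp _ P) (MpPsi.toRep_implements _ P) t ht) Ψ
  -- `ω(s n(t)) Ψ = op(P)⁻¹ (unipOpPi c_t (op(P) Ψ))`
  have hω : MpPsi.toRep (localSchrodinger (maximalRealSubfield L) ((n₁ + n₂) + (n₁ + n₂))
        (gramD (maximalRealSubfield L) (n₁ + n₂) (UnitaryGroup.finSum n₁ n₂ T₁ T₂)) v)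
        ((localSplittingDatumCM L v μ (n₁ + n₂) (UnitaryGroup.isSymm_finSum hT₁ hT₂) (isUnit_det_finSum L n₁ n₂ hT₁d hT₂d) rfl χ hχ).localSplitting
          (nElem (maximalRealSubfield L) L (IsCMField.complexConj L) v (n₁ + n₂) (T₀ := UnitaryGroup.finSum n₁ n₂ T₁ T₂) rfl t ht)) Ψ =
      (MpPsi.toOp _ P).symm
        (unipOpPi (isLocallyConstant_of_isContinuousNontrivial (isContinuousNontrivial_adeleAddCharAt (maximalRealSubfield L) v))
          (Matrix.mulVecLin (cOfFix (localGram (maximalRealSubfield L) ((n₁ + n₂) + (n₁ + n₂)) (gramD (maximalRealSubfield L) (n₁ + n₂) (UnitaryGroup.finSum n₁ n₂ T₁ T₂)) v)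
            (MpPsi.proj _ P *
              iotaD (maximalRealSubfield L) L (IsCMField.complexConj L) (complexConj_imagUnit L) (imagUnit_ne_zero L) (imagUnit_mul_self L) v
                (n₁ + n₂) (UnitaryGroup.isSymm_finSum hT₁ hT₂) rfl
                (nElem (maximalRealSubfield L) L (IsCMField.complexConj L) v (n₁ + n₂) (T₀ := UnitaryGroup.finSum n₁ n₂ T₁ T₂) rfl t ht) *
              (MpPsi.proj _ P)⁻¹)))
          (MpPsi.toOp _ P Ψ)) := by
    rw [LinearEquiv.eq_symm_apply]
    exact hword
  -- `F_Ψ(w₁ · n(t)) = F_{ω(s n(t)) Ψ}(w₁)` (`ω(m₀ · s(w₁ n)) = ω(m₀) ω(s w₁) ω(s n) = ω(m₀ · s w₁) ω(s n)`, ★ F4a part 1 §0)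
  have hmul : swSectionLoc L v
        (localSplittingDatumCM L v μ (n₁ + n₂) (UnitaryGroup.isSymm_finSum hT₁ hT₂) (isUnit_det_finSum L n₁ n₂ hT₁d hT₂d) rfl χ hχ).localSplitting
        m₀ Ψ
        (blkLoc (maximalRealSubfield L) L (IsCMField.complexConj L) v n₁ n₂ (T₁ := T₁) (T₂ := T₂) rfl rfl
            (weylDelta (maximalRealSubfield L) L (IsCMField.complexConj L) v n₁ (T₀ := T₁) rfl) *
          nElem (maximalRealSubfield L) L (IsCMField.complexConj L) v (n₁ + n₂) (T₀ := UnitaryGroup.finSum n₁ n₂ T₁ T₂) rfl t ht) =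
      swSectionLoc L v
        (localSplittingDatumCM L v μ (n₁ + n₂) (UnitaryGroup.isSymm_finSum hT₁ hT₂) (isUnit_det_finSum L n₁ n₂ hT₁d hT₂d) rfl χ hχ).localSplitting
        m₀
        (MpPsi.toRep (localSchrodinger (maximalRealSubfield L) ((n₁ + n₂) + (n₁ + n₂)) (gramD (maximalRealSubfield L) (n₁ + n₂) (UnitaryGroup.finSum n₁ n₂ T₁ T₂)) v)
          ((localSplittingDatumCM L v μ (n₁ + n₂) (UnitaryGroup.isSymm_finSum hT₁ hT₂) (isUnit_det_finSum L n₁ n₂ hT₁d hT₂d) rfl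
              χ hχ).localSplitting
            (nElem (maximalRealSubfield L) L (IsCMField.complexConj L) v (n₁ + n₂) (T₀ := UnitaryGroup.finSum n₁ n₂ T₁ T₂) rfl t ht)) Ψ)
        (blkLoc (maximalRealSubfield L) L (IsCMField.complexConj L) v n₁ n₂ (T₁ := T₁) (T₂ := T₂) rfl rfl
          (weylDelta (maximalRealSubfield L) L (IsCMField.complexConj L) v n₁ (T₀ := T₁) rfl)) := by
    unfold swSectionLoc
    rw [rep_mul_splitting_mul_apply
        (localSplittingDatumCM L v μ (n₁ + n₂) (UnitaryGroup.isSymm_finSum hT₁ hT₂) (isUnit_det_finSum L n₁ n₂ hT₁d hT₂d) rfl χ hχ).localSplitting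
        (MpPsi.toRep (localSchrodinger (maximalRealSubfield L) ((n₁ + n₂) + (n₁ + n₂)) (gramD (maximalRealSubfield L) (n₁ + n₂) (UnitaryGroup.finSum n₁ n₂ T₁ T₂)) v)) m₀
        (blkLoc (maximalRealSubfield L) L (IsCMField.complexConj L) v n₁ n₂ (T₁ := T₁) (T₂ := T₂) rfl rfl
          (weylDelta (maximalRealSubfield L) L (IsCMField.complexConj L) v n₁ (T₀ := T₁) rfl))
        (nElem (maximalRealSubfield L) L (IsCMField.complexConj L) v (n₁ + n₂) (T₀ := UnitaryGroup.finSum n₁ n₂ T₁ T₂) rfl t ht) Ψ,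
      rep_mul_apply (MpPsi.toRep (localSchrodinger (maximalRealSubfield L) ((n₁ + n₂) + (n₁ + n₂)) (gramD (maximalRealSubfield L) (n₁ + n₂) (UnitaryGroup.finSum n₁ n₂ T₁ T₂)) v)) m₀]
  -- assemble by transitivity (no `rw` on the big goal: its motive check is `whnf`-expensive)
  exact hmul.trans ((congrArg (fun Φ => swSectionLoc L v
    (localSplittingDatumCM L v μ (n₁ + n₂) (UnitaryGroup.isSymm_finSum hT₁ hT₂) (isUnit_det_finSum L n₁ n₂ hT₁d hT₂d) rfl χ hχ).localSplitting
    m₀ Φ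
    (blkLoc (maximalRealSubfield L) L (IsCMField.complexConj L) v n₁ n₂ (T₁ := T₁) (T₂ := T₂) rfl rfl
      (weylDelta (maximalRealSubfield L) L (IsCMField.complexConj L) v n₁ (T₀ := T₁) rfl))) hω).trans (hc _))

end Summit.HodgeConjecture.HodgeConjecture.Cruxes.HLiu418.K2LiuLocalSWMiddleCellValues

end
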